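import Literature.MathematicalPhysics.QuantumLattice.ReducedBCSTorus
import HarnessLib

/-!
# Richardson's exact eigenstates of the reduced BCS (pairing-force) Hamiltonian — proof

Topic `MathematicalPhysics/QuantumLattice`. This file DISCHARGES the named fact
`richardson_exact_eigenstates d L` of `ReducedBCSTorus.lean` (Richardson 1963; von Delft–Ralph 2001,
§5.1.1; statement unchanged): for level energies `ε`, unblocked levels `U`, coupling `G ≠ 0` and every
solution `(E_ν)_{ν<n}` of Richardson's equations `1/G - Σ_{j∈U} 1/(2ε_j - E_ν) + Σ_{μ≠ν} 2/(E_μ - E_ν) = 0`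
(pairwise distinct `E_ν` off the poles `2ε_j`), the vector `Ψ = Π_ν B†(E_ν) |0⟩`,
`B†(E) = Σ_{j∈U} b†_j/(2ε_j - E)`, satisfies `Ĥ_U Ψ = (Σ_ν E_ν) Ψ` for
`Ĥ_U = Σ_{j∈U} 2ε_j b†_j b_j - G B†_0 B_0`, `B_0 = Σ_{j∈U} b_j`, in the full fermionic Fock space of the
torus — `theorem richardson_exact_eigenstates_holds`. No definition and no new fact is introduced.

## The printed proof and how it is followed

von Delft–Ralph, App. B.1 ("Derivation of eigenstates and eigenvalues", B.1.3–B.1.4; a proof due to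
Richardson): commute `Ĥ_U` to the right past the `B†_ν` (B.1.3), using
`[b†_j b_j, B†_ν] = b†_j/(2ε_j - E_ν)`, `[B_0, B†_ν] = Σ_j (1 - 2b†_j b_j)/(2ε_j - E_ν)`, hence
`[Ĥ_U, B†_ν] = E_ν B†_ν + B†_0 [1 - g Σ_j (1 - 2b†_j b_j)/(2ε_j - E_ν)]`; the left-over `b†_j b_j` terms
are cured (B.1.4) by the partial-fraction commutator
`[Σ_j 2G B†_0 b†_j b_j/(2ε_j - E_ν), B†_μ] = 2G B†_0 (B†_ν - B†_μ)/(E_ν - E_μ)`, and after renaming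
dummy indices the coefficient of each `B†_0 Π_{η≠ν} B†_η |0⟩` is Richardson's equation.
The only deviation: the fact is stated in the FULL Fock space, where the hard-core boson commutator
is `[b_j, b†_k] = δ_{jk}(1 - n_{j↑} - n_{-j↓})` (`pairMode_commutator_conjTranspose`) rather than
`δ_{jk}(1 - 2b†_j b_j)`; since `[n_{j↑} + n_{-j↓}, b†_k] = 2δ_{jk} b†_k = [2b†_j b_j, b†_k]`
(`pairLevelNumber_commutator_pairMode_conjTranspose`) and both operators kill the vacuum, the printed
computation goes through verbatim with `n_{j↑} + n_{-j↓}` in place of `2b†_j b_j`.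

Structure: (1) vacuum annihilation `c_{kσ}|0⟩ = b_k|0⟩ = n_{kσ}|0⟩ = 0`; (2) the commutators
`[n_{kσ}, c†_{k'σ'}]`, `[n_{j↑} + n_{-j↓}, b†_k]`; (3) the three commutators of the parts of `Ĥ_U` with a
weighted pair creator `Σ_k θ_k b†_k` (from the tree's hard-core boson relations
`pairNumber_commutator_conjTranspose`, `pairMode_commutator_conjTranspose`, `pairMode_comm`), and their
specialisation to `B†(E)` including the partial-fraction identity of B.1.4; (4) the abstract
bookkeeping identities of B.1.3–B.1.4 for `List` products of commuting creators
(`kineticLike_mul_prod`, `numberLike_mulVec_prod_mulVec`, `pairSumLike_mulVec_prod_mulVec`), proved by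
induction on the list with the omitted factor written `List.erase`; (5) the discharge, where
Richardson's equations (over `Finset.univ.erase ν`) are matched with the list sums over
`(List.finRange n).erase ν`.

## Mathlib / tree search

Tree (REUSED, `ReducedBCSTorus`): `momentumAnnihilation/Creation/Number`, `pairMode`,
`richardsonHamiltonian`, `richardsonPairCreator`, `IsRichardsonSolution`, the momentum-space CAR
`momentumAnnihilation_mul_momentumCreation`, `momentumCreation_mul_eq_neg`, `momentumCreation_mul_self`,
the hard-core boson relations `pairMode_comm`, `pairMode_commutator_conjTranspose`,
`pairNumber_commutator_conjTranspose`; `annihilation_mulVec_vacuum_holds` (`HubbardWave0Proofs`). The `d = 2` specialisations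
`momentumAnnihilation_mulVec_vacuum`, `pairMode_mulVec_vacuum`, `pairMode_conjTranspose_comm` exist in
`PairedProductStates` / `PairFieldPairedVectors` (heavier imports, fixed `d = 2`); the general-`d`
versions needed here carry the suffix `_anyDim`.
Mathlib: `List.erase_cons_head/tail`, `List.sum_map_erase`, `List.ofFn_eq_map`, `List.sum_ofFn`,
`Finset.add_sum_erase`, `Matrix.mulVec_mulVec`. `lean search 'richardson|Bethe ansatz|Gaudin'`: nothing
else in Mathlib or the tree.

## References

* J. von Delft, D. C. Ralph, *Spectroscopy of discrete energy levels in ultrasmall metallic grains*,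
  Phys. Rep. 345 (2001) 61–173 = arXiv:cond-mat/0101019: §5.1.1 (statement, eq. (95)), App. B.1
  (B.1.1 hard-core boson relations; B.1.3–B.1.4: the derivation followed here). [VondelftRalph2001]
* R. W. Richardson, *A restricted class of exact eigenstates of the pairing-force Hamiltonian*,
  Phys. Lett. 3 (1963) 277–279. [Richardson1963]
* O. Bratteli, D. W. Robinson, *Operator Algebras and Quantum Statistical Mechanics 2*, 2nd ed.
  (1997), §5.2.1–5.2.2 (CAR algebra, Fock vacuum). [BratteliRobinsonII1997]
-/

open Matrix Finset Literature.Probability.LatticeModels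
open scoped ComplexConjugate

namespace Literature.MathematicalPhysics.QuantumLattice

variable {d L : ℕ} [NeZero L]

/-! ### The vacuum is annihilated by the Bloch modes, the pair modes and the occupation numbers -/

/-- `c_{kσ} |0⟩ = 0`: the Bloch-mode annihilation operators kill the Fock vacuum (they are linear
combinations of the `c_{xσ}`, `annihilation_mulVec_vacuum_holds`). Bratteli–Robinson II §5.2.2.
[cite: BratteliRobinsonII1997, §5.2.2] -/
theorem momentumAnnihilation_mulVec_vacuum_anyDim (k : TorusSite d L) (σ : Fin 2) :
    momentumAnnihilation k σ *ᵥ (vacuum : Fock (Orb (FermionTorus d L))) = 0 := by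
  unfold momentumAnnihilation
  rw [Matrix.sum_mulVec]
  refine Finset.sum_eq_zero fun x _ => ?_
  rw [smul_mulVec, annihilation_mulVec_vacuum_holds, smul_zero]

/-- `b_k |0⟩ = 0`. von Delft–Ralph 2001, App. B.1 (`H_U |0⟩ = 0`). [cite: VondelftRalph2001, App. B.1] -/
theorem pairMode_mulVec_vacuum_anyDim (k : TorusSite d L) :
    pairMode k *ᵥ (vacuum : Fock (Orb (FermionTorus d L))) = 0 := by
  rw [pairMode, ← mulVec_mulVec, momentumAnnihilation_mulVec_vacuum_anyDim, mulVec_zero]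

/-- `n_{kσ} |0⟩ = 0`. Bratteli–Robinson II §5.2.2. [cite: BratteliRobinsonII1997, §5.2.2] -/
theorem momentumNumber_mulVec_vacuum (k : TorusSite d L) (σ : Fin 2) :
    momentumNumber k σ *ᵥ (vacuum : Fock (Orb (FermionTorus d L))) = 0 := by
  rw [momentumNumber, ← mulVec_mulVec, momentumAnnihilation_mulVec_vacuum_anyDim, mulVec_zero]

/-! ### Commutators of the occupation numbers with the pair creators -/

/-- `[n_{kσ}, c†_{k'σ'}] = δ_{kk'} δ_{σσ'} c†_{kσ}`: an occupation number counts the created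
fermion (from the momentum-space CAR). Bratteli–Robinson II §5.2.1 (CAR algebra relations).
[cite: BratteliRobinsonII1997, §5.2.1] -/
theorem momentumNumber_commutator_momentumCreation (k k' : TorusSite d L) (σ σ' : Fin 2) :
    momentumNumber k σ * momentumCreation k' σ' - momentumCreation k' σ' * momentumNumber k σ =
      if k = k' ∧ σ = σ' then momentumCreation k σ else 0 := by
  have h1 := momentumAnnihilation_mul_momentumCreation k k' σ σ'
  by_cases hp : k = k' ∧ σ = σ'
  · obtain ⟨rfl, rfl⟩ := hp
    rw [if_pos ⟨rfl, rfl⟩] at h1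
    rw [if_pos ⟨rfl, rfl⟩, momentumNumber, Matrix.mul_assoc, h1, Matrix.mul_sub, Matrix.mul_one,
      ← Matrix.mul_assoc, momentumCreation_mul_self, Matrix.zero_mul, sub_zero, sub_zero]
  · rw [if_neg hp] at h1
    rw [if_neg hp, momentumNumber, Matrix.mul_assoc, h1, zero_sub, Matrix.mul_neg,
      ← Matrix.mul_assoc, momentumCreation_mul_eq_neg k k' σ σ', neg_mul, neg_neg, Matrix.mul_assoc,
      sub_self]

/-- `[n_{j↑} + n_{-j↓}, b†_k] = 2 δ_{jk} b†_k`: the pair-level occupation `n_{j↑} + n_{-j↓}` has the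
same commutator with the pair creators as `2 b†_j b_j` (von Delft–Ralph's third hard-core boson
relation, `pairNumber_commutator_conjTranspose`), in the full Fock space.
von Delft–Ralph 2001, §4.2.3 and App. B.1. [cite: VondelftRalph2001, §4.2.3] -/
theorem pairLevelNumber_commutator_pairMode_conjTranspose (j k : TorusSite d L) :
    (momentumNumber j 0 + momentumNumber (-j) 1) * (pairMode k)ᴴ -
        (pairMode k)ᴴ * (momentumNumber j 0 + momentumNumber (-j) 1) =
      if j = k then (2 : ℂ) • (pairMode k)ᴴ else 0 := by
  have e1 := momentumNumber_commutator_momentumCreation j k 0 0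
  have e2 := momentumNumber_commutator_momentumCreation j (-k) 0 1
  have e3 := momentumNumber_commutator_momentumCreation (-j) k 1 0
  have e4 := momentumNumber_commutator_momentumCreation (-j) (-k) 1 1
  rw [if_neg (fun h => absurd h.2 (by decide))] at e2 e3
  simp only [and_true, neg_inj] at e1 e4
  rw [pairMode_conjTranspose]
  have key : (momentumNumber j 0 + momentumNumber (-j) 1) *
        (momentumCreation k 0 * momentumCreation (-k) 1) -
      momentumCreation k 0 * momentumCreation (-k) 1 * (momentumNumber j 0 + momentumNumber (-j) 1) =
      ((momentumNumber j 0 * momentumCreation k 0 - momentumCreation k 0 * momentumNumber j 0) +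
        (momentumNumber (-j) 1 * momentumCreation k 0 - momentumCreation k 0 * momentumNumber (-j) 1)) *
          momentumCreation (-k) 1 +
        momentumCreation k 0 *
          ((momentumNumber j 0 * momentumCreation (-k) 1 - momentumCreation (-k) 1 * momentumNumber j 0) +
            (momentumNumber (-j) 1 * momentumCreation (-k) 1 -
              momentumCreation (-k) 1 * momentumNumber (-j) 1)) := by
    noncomm_ring
  rw [key, e1, e2, e3, e4]
  by_cases hjk : j = k
  · subst hjk
    simp only [if_true, add_zero, zero_add, two_smul]
  · simp [hjk]

/-! ### Commutators of the three parts of `H_U` with a general pair creator `Σ_k θ_k b†_k` -/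

/-- Pair creators commute: `b†_k b†_l = b†_l b†_k` (the `b_j` are hard-core bosons). von Delft–Ralph 2001,
§4.2.3. [cite: VondelftRalph2001, §4.2.3] -/
theorem pairMode_conjTranspose_comm_anyDim (k l : TorusSite d L) :
    (pairMode k)ᴴ * (pairMode l)ᴴ = (pairMode l)ᴴ * (pairMode k)ᴴ := by
  rw [← conjTranspose_mul, ← conjTranspose_mul, pairMode_comm]

/-- Weighted pair creators `Σ_{k∈U} θ_k b†_k`, `Σ_{k∈U'} θ'_k b†_k` commute (the `b†_j` are hard-core
bosons). von Delft–Ralph 2001, §4.2.3. [cite: VondelftRalph2001, §4.2.3] -/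
theorem commute_sum_smul_pairMode_conjTranspose (U U' : Finset (TorusSite d L))
    (θ θ' : TorusSite d L → ℂ) :
    Commute (∑ k ∈ U, θ k • (pairMode k)ᴴ) (∑ k ∈ U', θ' k • (pairMode k)ᴴ) :=
  Commute.sum_left _ _ _ fun k _ => Commute.sum_right _ _ _ fun l _ =>
    Commute.smul_left (Commute.smul_right (pairMode_conjTranspose_comm_anyDim k l) _) _

/-- `B†_0 = Σ_{i∈U} b†_i` commutes with every weighted pair creator `Σ_{k∈U'} θ_k b†_k` (hard-core
bosons). von Delft–Ralph 2001, §4.2.3. [cite: VondelftRalph2001, §4.2.3] -/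
theorem commute_sum_pairMode_conjTranspose_sum_smul (U U' : Finset (TorusSite d L))
    (θ : TorusSite d L → ℂ) :
    Commute (∑ i ∈ U, (pairMode i)ᴴ) (∑ k ∈ U', θ k • (pairMode k)ᴴ) :=
  Commute.sum_left _ _ _ fun k _ => Commute.sum_right _ _ _ fun l _ =>
    Commute.smul_right (pairMode_conjTranspose_comm_anyDim k l) _

/-- **First relation of App. B.1**: `[Σ_j c_j b†_j b_j, Σ_k θ_k b†_k] = Σ_k c_k θ_k b†_k`
(from `[b†_j b_j, b†_k] = δ_{jk} b†_j`). von Delft–Ralph 2001, App. B.1.3 (first commutator relation).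
[cite: VondelftRalph2001, App. B.1] -/
theorem sum_smul_pairNumber_commutator_sum_smul_pairMode_conjTranspose (U : Finset (TorusSite d L))
    (c θ : TorusSite d L → ℂ) :
    (∑ j ∈ U, c j • ((pairMode j)ᴴ * pairMode j)) * (∑ k ∈ U, θ k • (pairMode k)ᴴ) -
        (∑ k ∈ U, θ k • (pairMode k)ᴴ) * (∑ j ∈ U, c j • ((pairMode j)ᴴ * pairMode j)) =
      ∑ k ∈ U, (c k * θ k) • (pairMode k)ᴴ := by
  rw [Finset.sum_mul_sum, Finset.sum_mul_sum]
  conv_lhs => arg 2; rw [Finset.sum_comm]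
  rw [← Finset.sum_sub_distrib]
  refine Finset.sum_congr rfl fun j hj => ?_
  rw [← Finset.sum_sub_distrib]
  have hk : ∀ k ∈ U, c j • ((pairMode j)ᴴ * pairMode j) * (θ k • (pairMode k)ᴴ) -
      θ k • (pairMode k)ᴴ * (c j • ((pairMode j)ᴴ * pairMode j)) =
      if j = k then (c j * θ j) • (pairMode j)ᴴ else 0 := by
    intro k _
    rw [smul_mul_smul_comm, smul_mul_smul_comm, mul_comm (θ k) (c j), ← smul_sub,
      pairNumber_commutator_conjTranspose]
    split_ifs with h
    · subst h; rfl
    · rw [smul_zero]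
  rw [Finset.sum_congr rfl hk, Finset.sum_ite_eq, if_pos hj]

/-- **Second relation of App. B.1, full Fock space**:
`[Σ_{j∈U} b_j, Σ_{k∈U} θ_k b†_k] = Σ_{k∈U} θ_k (1 - n_{k↑} - n_{-k↓})` (from the hard-core boson
commutator `[b_j, b†_k] = δ_{jk}(1 - n_{k↑} - n_{-k↓})`; on pair states `n_{k↑} + n_{-k↓} = 2b†_k b_k`).
von Delft–Ralph 2001, App. B.1.3 (second commutator relation). [cite: VondelftRalph2001, App. B.1] -/
theorem sum_pairMode_commutator_sum_smul_pairMode_conjTranspose (U : Finset (TorusSite d L))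
    (θ : TorusSite d L → ℂ) :
    (∑ j ∈ U, pairMode j) * (∑ k ∈ U, θ k • (pairMode k)ᴴ) -
        (∑ k ∈ U, θ k • (pairMode k)ᴴ) * (∑ j ∈ U, pairMode j) =
      ∑ k ∈ U, θ k • (1 - momentumNumber k 0 - momentumNumber (-k) 1) := by
  rw [Finset.sum_mul_sum, Finset.sum_mul_sum]
  conv_lhs => arg 2; rw [Finset.sum_comm]
  rw [← Finset.sum_sub_distrib]
  refine Finset.sum_congr rfl fun j hj => ?_
  rw [← Finset.sum_sub_distrib]
  have hk : ∀ k ∈ U, pairMode j * (θ k • (pairMode k)ᴴ) - θ k • (pairMode k)ᴴ * pairMode j =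
      if j = k then θ j • (1 - momentumNumber j 0 - momentumNumber (-j) 1) else 0 := by
    intro k _
    rw [mul_smul_comm, smul_mul_assoc, ← smul_sub, pairMode_commutator_conjTranspose]
    split_ifs with h
    · subst h; rfl
    · rw [smul_zero]
  rw [Finset.sum_congr rfl hk, Finset.sum_ite_eq, if_pos hj]

/-- **The commutator that cures the hard-core complication (App. B.1.4), full Fock space**:
`[Σ_{j∈U} w_j (n_{j↑} + n_{-j↓}), Σ_{k∈U} θ_k b†_k] = Σ_{k∈U} 2 w_k θ_k b†_k`.
von Delft–Ralph 2001, App. B.1.4 (first line of the curing commutator). [cite: VondelftRalph2001, App. B.1] -/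
theorem sum_smul_pairLevelNumber_commutator_sum_smul_pairMode_conjTranspose
    (U : Finset (TorusSite d L)) (w θ : TorusSite d L → ℂ) :
    (∑ j ∈ U, w j • (momentumNumber j 0 + momentumNumber (-j) 1)) * (∑ k ∈ U, θ k • (pairMode k)ᴴ) -
        (∑ k ∈ U, θ k • (pairMode k)ᴴ) *
          (∑ j ∈ U, w j • (momentumNumber j 0 + momentumNumber (-j) 1)) =
      ∑ k ∈ U, (2 * (w k * θ k)) • (pairMode k)ᴴ := by
  rw [Finset.sum_mul_sum, Finset.sum_mul_sum]
  conv_lhs => arg 2; rw [Finset.sum_comm]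
  rw [← Finset.sum_sub_distrib]
  refine Finset.sum_congr rfl fun j hj => ?_
  rw [← Finset.sum_sub_distrib]
  have hk : ∀ k ∈ U, w j • (momentumNumber j 0 + momentumNumber (-j) 1) * (θ k • (pairMode k)ᴴ) -
      θ k • (pairMode k)ᴴ * (w j • (momentumNumber j 0 + momentumNumber (-j) 1)) =
      if j = k then (2 * (w j * θ j)) • (pairMode j)ᴴ else 0 := by
    intro k _
    rw [smul_mul_smul_comm, smul_mul_smul_comm, mul_comm (θ k) (w j), ← smul_sub,
      pairLevelNumber_commutator_pairMode_conjTranspose]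
    split_ifs with h
    · subst h; rw [smul_smul, mul_comm (w j * θ j) 2]
    · rw [smul_zero]
  rw [Finset.sum_congr rfl hk, Finset.sum_ite_eq, if_pos hj]

/-! ### The three commutators for Richardson's pair creators `B†(E) = Σ_{j∈U} b†_j / (2ε_j - E)` -/

/-- **`[Σ_j 2ε_j b†_j b_j, B†(E)] = B†_0 + E B†(E)`** (`B†_0 = Σ_{j∈U} b†_j`), for `E` off the
poles `2ε_j`: the kinetic part of `[H_U, B†_ν]` in von Delft–Ralph's App. B.1.3.
von Delft–Ralph 2001, App. B.1.3. [cite: VondelftRalph2001, App. B.1] -/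
theorem kinetic_commutator_richardsonPairCreator (ε : TorusSite d L → ℝ) (U : Finset (TorusSite d L))
    (E : ℂ) (hE : ∀ j ∈ U, ((2 * ε j : ℝ) : ℂ) ≠ E) :
    (∑ j ∈ U, ((2 * ε j : ℝ) : ℂ) • ((pairMode j)ᴴ * pairMode j)) * richardsonPairCreator ε U E -
        richardsonPairCreator ε U E * (∑ j ∈ U, ((2 * ε j : ℝ) : ℂ) • ((pairMode j)ᴴ * pairMode j)) =
      ∑ j ∈ U, (pairMode j)ᴴ + E • richardsonPairCreator ε U E := by
  rw [richardsonPairCreator, sum_smul_pairNumber_commutator_sum_smul_pairMode_conjTranspose,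
    Finset.smul_sum, ← Finset.sum_add_distrib]
  refine Finset.sum_congr rfl fun j hj => ?_
  have h : ((2 * ε j : ℝ) : ℂ) * (((2 * ε j : ℝ) : ℂ) - E)⁻¹ = 1 + E * (((2 * ε j : ℝ) : ℂ) - E)⁻¹ := by
    have h0 := sub_ne_zero.2 (hE j hj)
    field_simp
    ring
  rw [h, add_smul, one_smul, smul_smul]

/-- **`[B_0, B†(E)] = (Σ_{j∈U} 1/(2ε_j - E)) · 1 - Σ_{j∈U} (n_{j↑} + n_{-j↓})/(2ε_j - E)`**
(`B_0 = Σ_{j∈U} b_j`), the full-Fock-space form of the second commutator relation of App. B.1.3.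
von Delft–Ralph 2001, App. B.1.3. [cite: VondelftRalph2001, App. B.1] -/
theorem sum_pairMode_commutator_richardsonPairCreator (ε : TorusSite d L → ℝ)
    (U : Finset (TorusSite d L)) (E : ℂ) :
    (∑ j ∈ U, pairMode j) * richardsonPairCreator ε U E -
        richardsonPairCreator ε U E * (∑ j ∈ U, pairMode j) =
      (∑ j ∈ U, (((2 * ε j : ℝ) : ℂ) - E)⁻¹) • (1 : Matrix _ _ ℂ) -
        ∑ j ∈ U, (((2 * ε j : ℝ) : ℂ) - E)⁻¹ • (momentumNumber j 0 + momentumNumber (-j) 1) := by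
  rw [richardsonPairCreator, sum_pairMode_commutator_sum_smul_pairMode_conjTranspose, Finset.sum_smul,
    ← Finset.sum_sub_distrib]
  refine Finset.sum_congr rfl fun j _ => ?_
  rw [sub_sub, smul_sub]

/-- **The curing commutator of App. B.1.4, full Fock space, after partial fractions**:
`[Σ_{j∈U} (n_{j↑} + n_{-j↓})/(2ε_j - E), B†(E')] = (2/(E - E')) (B†(E) - B†(E'))` for `E ≠ E'` off
the poles. von Delft–Ralph 2001, App. B.1.4. [cite: VondelftRalph2001, App. B.1] -/
theorem pairLevelNumber_commutator_richardsonPairCreator (ε : TorusSite d L → ℝ)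
    (U : Finset (TorusSite d L)) {E E' : ℂ} (hEE' : E ≠ E') (hE : ∀ j ∈ U, ((2 * ε j : ℝ) : ℂ) ≠ E)
    (hE' : ∀ j ∈ U, ((2 * ε j : ℝ) : ℂ) ≠ E') :
    (∑ j ∈ U, (((2 * ε j : ℝ) : ℂ) - E)⁻¹ • (momentumNumber j 0 + momentumNumber (-j) 1)) *
          richardsonPairCreator ε U E' -
        richardsonPairCreator ε U E' *
          (∑ j ∈ U, (((2 * ε j : ℝ) : ℂ) - E)⁻¹ • (momentumNumber j 0 + momentumNumber (-j) 1)) =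
      (2 * (E - E')⁻¹) • (richardsonPairCreator ε U E - richardsonPairCreator ε U E') := by
  rw [richardsonPairCreator, richardsonPairCreator,
    sum_smul_pairLevelNumber_commutator_sum_smul_pairMode_conjTranspose, ← Finset.sum_sub_distrib,
    Finset.smul_sum]
  refine Finset.sum_congr rfl fun j hj => ?_
  rw [← sub_smul, smul_smul]
  congr 1
  have h1 := sub_ne_zero.2 (hE j hj)
  have h2 := sub_ne_zero.2 (hE' j hj)
  have h3 := sub_ne_zero.2 hEE'
  field_simp
  ring

/-! ### Vacuum annihilation of the three parts of `H_U` -/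

/-- `(Σ_j c_j b†_j b_j) |0⟩ = 0`. von Delft–Ralph 2001, App. B.1 (`H_U |0⟩ = 0`).
[cite: VondelftRalph2001, App. B.1] -/
theorem sum_smul_pairNumber_mulVec_vacuum (U : Finset (TorusSite d L)) (c : TorusSite d L → ℂ) :
    (∑ j ∈ U, c j • ((pairMode j)ᴴ * pairMode j)) *ᵥ (vacuum : Fock (Orb (FermionTorus d L))) = 0 := by
  rw [Matrix.sum_mulVec]
  refine Finset.sum_eq_zero fun j _ => ?_
  rw [smul_mulVec, ← mulVec_mulVec, pairMode_mulVec_vacuum_anyDim, mulVec_zero, smul_zero]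

/-- `B_0 |0⟩ = (Σ_j b_j) |0⟩ = 0`. von Delft–Ralph 2001, App. B.1. [cite: VondelftRalph2001, App. B.1] -/
theorem sum_pairMode_mulVec_vacuum (U : Finset (TorusSite d L)) :
    (∑ j ∈ U, pairMode j) *ᵥ (vacuum : Fock (Orb (FermionTorus d L))) = 0 := by
  rw [Matrix.sum_mulVec]
  exact Finset.sum_eq_zero fun j _ => pairMode_mulVec_vacuum_anyDim j

/-- `(Σ_j w_j (n_{j↑} + n_{-j↓})) |0⟩ = 0` (the Fock vacuum has no particles). Bratteli–Robinson II
§5.2.2. [cite: BratteliRobinsonII1997, §5.2.2] -/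
theorem sum_smul_pairLevelNumber_mulVec_vacuum (U : Finset (TorusSite d L)) (w : TorusSite d L → ℂ) :
    (∑ j ∈ U, w j • (momentumNumber j 0 + momentumNumber (-j) 1)) *ᵥ
        (vacuum : Fock (Orb (FermionTorus d L))) = 0 := by
  rw [Matrix.sum_mulVec]
  refine Finset.sum_eq_zero fun j _ => ?_
  rw [smul_mulVec, Matrix.add_mulVec, momentumNumber_mulVec_vacuum, momentumNumber_mulVec_vacuum,
    add_zero, smul_zero]

/-! ### Algebraic skeleton of App. B.1: commuting an operator to the right past `Π_ν B†_ν`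

The next lemmas are the bookkeeping identities of von Delft–Ralph's App. B.1.3–B.1.4, stated for
abstract square matrices `K` ("kinetic part"), `P'` (`B†_0`), `P` (`B_0`), pair creators `R a`,
"number-like" operators `N a` and a vector `v` (the vacuum) subject to the commutation relations
proved above; the products over `ν` are `List` products, the omitted factor is `List.erase`. -/

section Helpers

variable {ι : Type*} {m : Type*} [Fintype m]

/-- `M (Σ_{a∈l} f a) = Σ_{a∈l} M (f a)` for a matrix acting on vectors (list form). [folklore] -/
private theorem mulVec_list_sum_map (M : Matrix m m ℂ) (l : List ι) (f : ι → m → ℂ) :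
    M *ᵥ (l.map f).sum = (l.map fun a => M *ᵥ f a).sum := by
  induction l with
  | nil => simp
  | cons a t ih => rw [List.map_cons, List.sum_cons, List.map_cons, List.sum_cons, Matrix.mulVec_add, ih]

/-- `(Σ_{a∈l} F a) v = Σ_{a∈l} F a v` (list form). [folklore] -/
private theorem list_sum_map_mulVec (l : List ι) (F : ι → Matrix m m ℂ) (v : m → ℂ) :
    (l.map F).sum *ᵥ v = (l.map fun a => F a *ᵥ v).sum := by
  induction l with
  | nil => simp
  | cons a t ih => rw [List.map_cons, List.sum_cons, List.map_cons, List.sum_cons, Matrix.add_mulVec, ih]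

/-- `Σ_{a∈l} (f a + g a) = Σ f + Σ g` (list form, vectors). [folklore] -/
private theorem list_sum_map_add {V : Type*} [AddCommMonoid V] (l : List ι) (f g : ι → V) :
    (l.map fun a => f a + g a).sum = (l.map f).sum + (l.map g).sum := by
  induction l with
  | nil => simp
  | cons a t ih => rw [List.map_cons, List.sum_cons, List.map_cons, List.sum_cons, List.map_cons,
      List.sum_cons, ih, add_add_add_comm]

/-- `Σ_{a∈l} (f a - g a) = Σ f - Σ g` (list form). [folklore] -/
private theorem list_sum_map_sub {V : Type*} [AddCommGroup V] (l : List ι) (f g : ι → V) :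
    (l.map fun a => f a - g a).sum = (l.map f).sum - (l.map g).sum := by
  induction l with
  | nil => simp
  | cons a t ih => rw [List.map_cons, List.sum_cons, List.map_cons, List.sum_cons, List.map_cons,
      List.sum_cons, ih, add_sub_add_comm]

/-- `Σ_{a∈l} (r a • x) = (Σ_{a∈l} r a) • x` (list form). [folklore] -/
private theorem list_sum_map_smul_const {V : Type*} [AddCommGroup V] [Module ℂ V] (l : List ι) (r : ι → ℂ)
    (x : V) : (l.map fun a => r a • x).sum = (l.map r).sum • x := by
  induction l with
  | nil => simp
  | cons a t ih => rw [List.map_cons, List.sum_cons, List.map_cons, List.sum_cons, ih, add_smul]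

/-- `r • Σ_{a∈l} f a = Σ_{a∈l} r • f a` (list form). [folklore] -/
private theorem list_smul_sum_map {V : Type*} [AddCommGroup V] [Module ℂ V] (l : List ι) (f : ι → V) (r : ℂ) :
    r • (l.map f).sum = (l.map fun a => r • f a).sum := by
  induction l with
  | nil => simp
  | cons a t ih => rw [List.map_cons, List.sum_cons, List.map_cons, List.sum_cons, smul_add, ih]

end Helpers

section Skeleton

variable {ι : Type*} [DecidableEq ι] {m : Type*} [Fintype m] [DecidableEq m]

/-- In a product of pairwise commuting factors, the factor `f a` can be moved to the front:
`f a · Π_{l ∖ a} f = Π_l f` (`a ∈ l`). [folklore] -/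
private theorem mul_prod_map_erase_of_comm {M : Type*} [Monoid M] (f : ι → M)
    (hf : ∀ a b, f a * f b = f b * f a) :
    ∀ (l : List ι) (a : ι), a ∈ l → f a * ((l.erase a).map f).prod = (l.map f).prod
  | [], _, h => absurd h List.not_mem_nil
  | b :: t, a, h => by
      by_cases hab : b = a
      · subst hab
        rw [List.erase_cons_head, List.map_cons, List.prod_cons]
      · have hat : a ∈ t := (List.mem_cons.1 h).resolve_left (Ne.symm hab)
        rw [List.erase_cons_tail (by simpa using hab), List.map_cons, List.map_cons, List.prod_cons,
          List.prod_cons, ← mul_assoc, hf a b, mul_assoc, mul_prod_map_erase_of_comm f hf t a hat]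

/-- **Commuting the kinetic part to the right past `Π_ν B†_ν` (App. B.1.3).**
If `[K, R a] = P' + E_a R a`, `P'` commutes with the `R a` and the `R a` commute pairwise, then
`K Π_l R = (Π_l R) K + (Σ_l E) Π_l R + P' Σ_{a∈l} Π_{l∖a} R`.
von Delft–Ralph 2001, App. B.1.3 (the commutator of `H_U` with `Π_ν B†_ν`). [cite: VondelftRalph2001, App. B.1] -/
theorem kineticLike_mul_prod (K P' : Matrix m m ℂ) (R : ι → Matrix m m ℂ) (E : ι → ℂ)
    (hKR : ∀ a, K * R a - R a * K = P' + E a • R a) (hP'R : ∀ a, P' * R a = R a * P')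
    (hRR : ∀ a b, R a * R b = R b * R a) :
    ∀ l : List ι, l.Nodup →
      K * (l.map R).prod = (l.map R).prod * K + (l.map E).sum • (l.map R).prod +
        P' * (l.map fun a => ((l.erase a).map R).prod).sum
  | [], _ => by simp
  | a :: t, hl => by
      obtain ⟨hat, ht⟩ := List.nodup_cons.1 hl
      have ih := kineticLike_mul_prod K P' R E hKR hP'R hRR t ht
      have hK' : K * R a = R a * K + (P' + E a • R a) := sub_eq_iff_eq_add'.1 (hKR a)
      have herase : (t.map fun b => (((a :: t).erase b).map R).prod) =
          t.map fun b => R a * ((t.erase b).map R).prod := by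
        refine List.map_congr_left fun b hb => ?_
        rw [List.erase_cons_tail (by simpa using (ne_of_mem_of_not_mem hb hat).symm), List.map_cons,
          List.prod_cons]
      rw [List.map_cons, List.prod_cons, List.map_cons, List.sum_cons, List.map_cons, List.sum_cons,
        List.erase_cons_head, herase, List.sum_map_mul_left]
      calc K * (R a * (t.map R).prod) = K * R a * (t.map R).prod := (Matrix.mul_assoc _ _ _).symm
        _ = R a * (K * (t.map R).prod) + P' * (t.map R).prod + E a • (R a * (t.map R).prod) := by
            rw [hK', Matrix.add_mul, Matrix.add_mul, Matrix.mul_assoc, Matrix.smul_mul, add_assoc]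
        _ = R a * ((t.map R).prod * K + (t.map E).sum • (t.map R).prod +
              P' * (t.map fun b => ((t.erase b).map R).prod).sum) +
              P' * (t.map R).prod + E a • (R a * (t.map R).prod) := by rw [ih]
        _ = _ := by
            simp only [Matrix.mul_add]
            rw [Matrix.mul_smul, ← Matrix.mul_assoc (R a) P', ← hP'R a, Matrix.mul_assoc P' (R a),
              ← Matrix.mul_assoc (R a) (t.map R).prod K, add_smul]
            abel

/-- **The number-like operator commuted to the right onto the vacuum (App. B.1.4).**  If
`[N a₀, R b] = c_{a₀ b} (R a₀ - R b)` for `a₀ ≠ b`, the `R`'s commute and `N a₀ v = 0`, then for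
`a₀ ∉ l`: `N a₀ (Π_l R) v = Σ_{b∈l} c_{a₀ b} (R a₀ - R b) (Π_{l∖b} R) v`.
von Delft–Ralph 2001, App. B.1.4 (the display after the curing commutator). [cite: VondelftRalph2001, App. B.1] -/
theorem numberLike_mulVec_prod_mulVec (R N : ι → Matrix m m ℂ) (c : ι → ι → ℂ) (v : m → ℂ)
    (hRR : ∀ a b, R a * R b = R b * R a)
    (hNR : ∀ a b, a ≠ b → N a * R b - R b * N a = c a b • (R a - R b)) (hNv : ∀ a, N a *ᵥ v = 0) :
    ∀ (l : List ι) (a₀ : ι), l.Nodup → a₀ ∉ l →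
      N a₀ *ᵥ ((l.map R).prod *ᵥ v) =
        (l.map fun b => c a₀ b • ((R a₀ - R b) *ᵥ (((l.erase b).map R).prod *ᵥ v))).sum
  | [], a₀, _, _ => by simp [hNv a₀, Matrix.one_mulVec]
  | b :: t, a₀, hl, ha₀ => by
      obtain ⟨hbt, ht⟩ := List.nodup_cons.1 hl
      have hab : a₀ ≠ b := fun h => ha₀ (h ▸ List.mem_cons_self)
      have hat : a₀ ∉ t := fun h => ha₀ (List.mem_cons_of_mem b h)
      have ih := numberLike_mulVec_prod_mulVec R N c v hRR hNR hNv t a₀ ht hat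
      have hN' : N a₀ * R b = R b * N a₀ + c a₀ b • (R a₀ - R b) := sub_eq_iff_eq_add'.1 (hNR a₀ b hab)
      have herase : (t.map fun b' => c a₀ b' • ((R a₀ - R b') *ᵥ ((((b :: t).erase b').map R).prod *ᵥ v))) =
          t.map fun b' => c a₀ b' • ((R a₀ - R b') *ᵥ ((R b * ((t.erase b').map R).prod) *ᵥ v)) := by
        refine List.map_congr_left fun b' hb' => ?_
        rw [List.erase_cons_tail (by simpa using (ne_of_mem_of_not_mem hb' hbt).symm), List.map_cons,
          List.prod_cons]
      rw [List.map_cons, List.prod_cons, List.map_cons, List.sum_cons, List.erase_cons_head, herase,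
        mulVec_mulVec, ← Matrix.mul_assoc, hN', Matrix.add_mul, Matrix.add_mulVec, Matrix.mul_assoc,
        ← mulVec_mulVec, ← mulVec_mulVec, ih, Matrix.smul_mul, smul_mulVec, ← mulVec_mulVec, add_comm]
      congr 1
      rw [mulVec_list_sum_map]
      congr 1
      refine List.map_congr_left fun b' _ => ?_
      have hcomm : R b * (R a₀ - R b') = (R a₀ - R b') * R b := by
        rw [Matrix.mul_sub, Matrix.sub_mul, hRR b a₀, hRR b b']
      rw [mulVec_smul, mulVec_mulVec, mulVec_mulVec, mulVec_mulVec, ← Matrix.mul_assoc, hcomm]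

/-- **`B_0` commuted to the right onto the vacuum (App. B.1.3–B.1.4).**  If
`[P, R a] = s_a · 1 - N a`, `P v = 0`, and `N`, `R`, `c` are as in `numberLike_mulVec_prod_mulVec`
with `c` antisymmetric, then
`P (Π_l R) v = Σ_{a∈l} (s_a + Σ_{b∈l∖a} c_{a b}) (Π_{l∖a} R) v`.
von Delft–Ralph 2001, App. B.1.3–B.1.4. [cite: VondelftRalph2001, App. B.1] -/
theorem pairSumLike_mulVec_prod_mulVec (P : Matrix m m ℂ) (R N : ι → Matrix m m ℂ) (s : ι → ℂ)
    (c : ι → ι → ℂ) (v : m → ℂ) (hRR : ∀ a b, R a * R b = R b * R a)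
    (hPR : ∀ a, P * R a - R a * P = s a • (1 : Matrix m m ℂ) - N a) (hPv : P *ᵥ v = 0)
    (hNR : ∀ a b, a ≠ b → N a * R b - R b * N a = c a b • (R a - R b)) (hNv : ∀ a, N a *ᵥ v = 0)
    (hc : ∀ a b, a ≠ b → c a b = -c b a) :
    ∀ l : List ι, l.Nodup →
      P *ᵥ ((l.map R).prod *ᵥ v) =
        (l.map fun a => (s a + ((l.erase a).map (c a)).sum) • (((l.erase a).map R).prod *ᵥ v)).sum
  | [], _ => by simp [hPv]
  | a :: t, hl => by
      obtain ⟨hat, ht⟩ := List.nodup_cons.1 hl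
      have ih := pairSumLike_mulVec_prod_mulVec P R N s c v hRR hPR hPv hNR hNv hc t ht
      have hN := numberLike_mulVec_prod_mulVec R N c v hRR hNR hNv t a ht hat
      have hP' : P * R a = R a * P + (s a • (1 : Matrix m m ℂ) - N a) := sub_eq_iff_eq_add'.1 (hPR a)
      -- the factor `R b` moved back into the product: `R b Π_{t∖b} R v = Π_t R v`
      have hback : ∀ b ∈ t, R b *ᵥ (((t.erase b).map R).prod *ᵥ v) = (t.map R).prod *ᵥ v := by
        intro b hb
        rw [mulVec_mulVec, mul_prod_map_erase_of_comm R hRR t b hb]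
      have herase : (t.map fun b => (s b + ((((a :: t).erase b).map (c b)).sum)) •
            (((((a :: t).erase b).map R).prod) *ᵥ v)) =
          t.map fun b => (s b + ((t.erase b).map (c b)).sum - c a b) •
            (R a *ᵥ ((((t.erase b).map R).prod) *ᵥ v)) := by
        refine List.map_congr_left fun b hb => ?_
        have hba : a ≠ b := (ne_of_mem_of_not_mem hb hat).symm
        rw [List.erase_cons_tail (by simpa using hba), List.map_cons, List.sum_cons, List.map_cons,
          List.prod_cons, hc b a hba.symm, ← mulVec_mulVec]
        congr 1
        ring
      rw [List.map_cons, List.prod_cons, List.map_cons, List.sum_cons, List.erase_cons_head, herase,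
        mulVec_mulVec, ← Matrix.mul_assoc, hP', Matrix.add_mul, Matrix.add_mulVec, Matrix.mul_assoc,
        ← mulVec_mulVec, ← mulVec_mulVec, ih, Matrix.sub_mul, Matrix.sub_mulVec, Matrix.smul_mul,
        Matrix.one_mul, smul_mulVec, ← mulVec_mulVec v (N a), hN, mulVec_list_sum_map]
      -- both sides are sums over `t` plus a multiple of `Π_t R v`; compare termwise
      have hNsplit : (t.map fun b => c a b • ((R a - R b) *ᵥ (((t.erase b).map R).prod *ᵥ v))) =
          t.map fun b => c a b • (R a *ᵥ (((t.erase b).map R).prod *ᵥ v)) - c a b • ((t.map R).prod *ᵥ v) := by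
        refine List.map_congr_left fun b hb => ?_
        rw [Matrix.sub_mulVec, smul_sub, hback b hb]
      have hih : (t.map fun b => R a *ᵥ ((s b + ((t.erase b).map (c b)).sum) •
            (((t.erase b).map R).prod *ᵥ v))) =
          t.map fun b => (s b + ((t.erase b).map (c b)).sum) • (R a *ᵥ (((t.erase b).map R).prod *ᵥ v)) := by
        refine List.map_congr_left fun b _ => ?_
        rw [mulVec_smul]
      rw [hNsplit, hih, list_sum_map_sub, list_sum_map_smul_const]
      have hsub : (t.map fun b => (s b + ((t.erase b).map (c b)).sum - c a b) •
            (R a *ᵥ (((t.erase b).map R).prod *ᵥ v))) =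
          t.map fun b => (s b + ((t.erase b).map (c b)).sum) • (R a *ᵥ (((t.erase b).map R).prod *ᵥ v)) -
            c a b • (R a *ᵥ (((t.erase b).map R).prod *ᵥ v)) := by
        refine List.map_congr_left fun b _ => ?_
        rw [sub_smul]
      rw [hsub, list_sum_map_sub, add_smul]
      abel

end Skeleton

/-! ### The discharge -/

/-- **Richardson's exact eigenstates of the reduced BCS model (Richardson 1963; von Delft–Ralph 2001,
§5.1.1 with App. B.1) — discharge of the named fact `richardson_exact_eigenstates d L`.**
For level energies `ε`, unblocked levels `U`, coupling `G ≠ 0` and every solution `(E_ν)_{ν<n}` of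
Richardson's equations, `Ĥ_U Π_ν B†(E_ν)|0⟩ = (Σ_ν E_ν) Π_ν B†(E_ν)|0⟩` in the full Fock space.
Proof as printed in App. B.1: `Ĥ_U` is commuted to the right past the `B†_ν`
(`kineticLike_mul_prod`, `pairSumLike_mulVec_prod_mulVec`, `numberLike_mulVec_prod_mulVec`) using
`[b†_j b_j, B†_ν] = b†_j/(2ε_j - E_ν)`, `[B_0, B†_ν] = Σ_j (1 - n_{j↑} - n_{-j↓})/(2ε_j - E_ν)` (the
full-Fock-space form of `(1 - 2b†_j b_j)`, same commutator with the `b†`) and the partial-fraction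
identity of B.1.4; the surviving terms `[1 - G Σ_j 1/(2ε_j - E_ν) + Σ_{μ≠ν} 2G/(E_μ - E_ν)] B†_0 Π_{η≠ν} B†_η |0⟩`
vanish by Richardson's equations (§5.1.1, eq. for `E_1, …, E_n`). [cite: VondelftRalph2001, §5.1.1 and App. B.1] -/
theorem richardson_exact_eigenstates_holds : ∀ (d L : ℕ) [NeZero L], richardson_exact_eigenstates d L := by
  intro d L _ ε U G hG n E hE
  obtain ⟨hinj, hpole, hrich⟩ := hE
  have hG' : (G : ℂ) ≠ 0 := Complex.ofReal_ne_zero.2 hG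
  -- the commutation relations of App. B.1 for Richardson's operators
  have hKR : ∀ ν : Fin n,
      (∑ j ∈ U, ((2 * ε j : ℝ) : ℂ) • ((pairMode j)ᴴ * pairMode j)) * richardsonPairCreator ε U (E ν) -
        richardsonPairCreator ε U (E ν) * (∑ j ∈ U, ((2 * ε j : ℝ) : ℂ) • ((pairMode j)ᴴ * pairMode j)) =
      ∑ j ∈ U, (pairMode j)ᴴ + E ν • richardsonPairCreator ε U (E ν) :=
    fun ν => kinetic_commutator_richardsonPairCreator ε U (E ν) (hpole ν)
  have hP'R : ∀ ν : Fin n, (∑ j ∈ U, (pairMode j)ᴴ) * richardsonPairCreator ε U (E ν) =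
      richardsonPairCreator ε U (E ν) * ∑ j ∈ U, (pairMode j)ᴴ :=
    fun ν => (commute_sum_pairMode_conjTranspose_sum_smul U U _).eq
  have hRR : ∀ ν μ : Fin n, richardsonPairCreator ε U (E ν) * richardsonPairCreator ε U (E μ) =
      richardsonPairCreator ε U (E μ) * richardsonPairCreator ε U (E ν) :=
    fun ν μ => (commute_sum_smul_pairMode_conjTranspose U U _ _).eq
  have hNR : ∀ ν μ : Fin n, ν ≠ μ →
      (∑ j ∈ U, (((2 * ε j : ℝ) : ℂ) - E ν)⁻¹ • (momentumNumber j 0 + momentumNumber (-j) 1)) *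
          richardsonPairCreator ε U (E μ) -
        richardsonPairCreator ε U (E μ) *
          (∑ j ∈ U, (((2 * ε j : ℝ) : ℂ) - E ν)⁻¹ • (momentumNumber j 0 + momentumNumber (-j) 1)) =
      (2 * (E ν - E μ)⁻¹) • (richardsonPairCreator ε U (E ν) - richardsonPairCreator ε U (E μ)) :=
    fun ν μ h => pairLevelNumber_commutator_richardsonPairCreator ε U (hinj.ne h) (hpole ν) (hpole μ)
  have hNv : ∀ ν : Fin n,
      (∑ j ∈ U, (((2 * ε j : ℝ) : ℂ) - E ν)⁻¹ • (momentumNumber j 0 + momentumNumber (-j) 1)) *ᵥ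
        (vacuum : Fock (Orb (FermionTorus d L))) = 0 :=
    fun ν => sum_smul_pairLevelNumber_mulVec_vacuum U _
  have hPR : ∀ ν : Fin n, (∑ j ∈ U, pairMode j) * richardsonPairCreator ε U (E ν) -
      richardsonPairCreator ε U (E ν) * (∑ j ∈ U, pairMode j) =
      (∑ j ∈ U, (((2 * ε j : ℝ) : ℂ) - E ν)⁻¹) • (1 : Matrix _ _ ℂ) -
        ∑ j ∈ U, (((2 * ε j : ℝ) : ℂ) - E ν)⁻¹ • (momentumNumber j 0 + momentumNumber (-j) 1) :=
    fun ν => sum_pairMode_commutator_richardsonPairCreator ε U (E ν)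
  have hPv := sum_pairMode_mulVec_vacuum (d := d) (L := L) U
  have hc : ∀ ν μ : Fin n, ν ≠ μ → (2 * (E ν - E μ)⁻¹ : ℂ) = -(2 * (E μ - E ν)⁻¹) := by
    intro ν μ _
    rw [← neg_sub (E ν) (E μ), inv_neg, mul_neg, neg_neg]
  -- the bookkeeping identities of App. B.1.3–B.1.4 for the list `ν = 0, …, n-1`
  have hKT := kineticLike_mul_prod _ _ (fun ν => richardsonPairCreator ε U (E ν)) E hKR hP'R hRR
    (List.finRange n) (List.nodup_finRange n)
  have hPT := pairSumLike_mulVec_prod_mulVec _ (fun ν => richardsonPairCreator ε U (E ν)) _ _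
    (fun ν μ => (2 * (E ν - E μ)⁻¹ : ℂ)) vacuum hRR hPR hPv hNR hNv hc (List.finRange n)
    (List.nodup_finRange n)
  -- Richardson's equations: every coefficient `1 - G (Σ_j 1/(2ε_j - E_ν) + Σ_{μ≠ν} 2/(E_ν - E_μ))` vanishes
  have hcoef : ∀ ν : Fin n, 1 - (G : ℂ) * ((∑ j ∈ U, (((2 * ε j : ℝ) : ℂ) - E ν)⁻¹) +
      (((List.finRange n).erase ν).map fun μ => (2 * (E ν - E μ)⁻¹ : ℂ)).sum) = 0 := by
    intro ν
    have hl : (((List.finRange n).erase ν).map fun μ => (2 * (E ν - E μ)⁻¹ : ℂ)).sum =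
        -∑ μ ∈ univ.erase ν, 2 * (E μ - E ν)⁻¹ := by
      have h1 := List.sum_map_erase (fun μ => (2 * (E ν - E μ)⁻¹ : ℂ)) (List.mem_finRange ν)
      have h2 : ((List.finRange n).map fun μ => (2 * (E ν - E μ)⁻¹ : ℂ)).sum =
          ∑ μ, 2 * (E ν - E μ)⁻¹ := by
        rw [← List.ofFn_eq_map, List.sum_ofFn]
      have h3 := Finset.add_sum_erase univ (fun μ => (2 * (E ν - E μ)⁻¹ : ℂ)) (Finset.mem_univ ν)
      rw [h2, ← h3] at h1
      rw [add_left_cancel h1, ← Finset.sum_neg_distrib]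
      exact Finset.sum_congr rfl fun μ hμ => hc ν μ (Finset.ne_of_mem_erase hμ).symm
    rw [hl]
    have h' := congrArg (fun x => (G : ℂ) * x) (hrich ν)
    simp only [mul_add, mul_sub, mul_inv_cancel₀ hG', mul_zero] at h'
    linear_combination h'
  -- assembling `H_U Ψ = 𝓔 Ψ + P' (Σ_ν (1 - G·coef_ν) Ψ^{(ν)})`
  rw [List.ofFn_eq_map]
  have hsumE : ((List.finRange n).map E).sum = ∑ ν, E ν := by rw [← List.ofFn_eq_map, List.sum_ofFn]
  have hKw : (∑ j ∈ U, ((2 * ε j : ℝ) : ℂ) • ((pairMode j)ᴴ * pairMode j)) *ᵥ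
      (((List.finRange n).map fun ν => richardsonPairCreator ε U (E ν)).prod *ᵥ
        (vacuum : Fock (Orb (FermionTorus d L)))) =
      (∑ ν, E ν) • (((List.finRange n).map fun ν => richardsonPairCreator ε U (E ν)).prod *ᵥ
        (vacuum : Fock (Orb (FermionTorus d L)))) +
      (∑ j ∈ U, (pairMode j)ᴴ) *ᵥ ((List.finRange n).map fun ν =>
        (((List.finRange n).erase ν).map fun μ => richardsonPairCreator ε U (E μ)).prod *ᵥ
          (vacuum : Fock (Orb (FermionTorus d L)))).sum := by
    rw [mulVec_mulVec, hKT, Matrix.add_mulVec, Matrix.add_mulVec, ← mulVec_mulVec,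
      sum_smul_pairNumber_mulVec_vacuum, mulVec_zero, zero_add, smul_mulVec, hsumE, ← mulVec_mulVec,
      list_sum_map_mulVec]
  rw [richardsonHamiltonian, Matrix.sub_mulVec, smul_mulVec, ← mulVec_mulVec _ (∑ i ∈ U, (pairMode i)ᴴ),
    hKw, hPT, add_sub_assoc, add_eq_left, ← mulVec_smul, ← Matrix.mulVec_sub, list_smul_sum_map,
    ← list_sum_map_sub]
  refine Eq.trans (congrArg ((∑ j ∈ U, (pairMode j)ᴴ) *ᵥ ·) (List.sum_eq_zero fun x hx => ?_))
    (mulVec_zero _)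
  obtain ⟨ν, _, rfl⟩ := List.mem_map.1 hx
  simp only [smul_smul]
  rw [← one_smul ℂ ((((List.finRange n).erase ν).map fun μ => richardsonPairCreator ε U (E μ)).prod *ᵥ
    (vacuum : Fock (Orb (FermionTorus d L)))), smul_smul, mul_one, ← sub_smul, hcoef ν, zero_smul]

end Literature.MathematicalPhysics.QuantumLattice
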